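import Literature.Barriers.Schanuel.LargeTranscendenceDegree
import Literature.NumberTheory.Transcendental.FourExponentialsConditional
import Literature.NumberTheory.Transcendental.OneMotiveToric
import Literature.NumberTheory.Transcendental.RankOneGridTrdegSchanuel
import HarnessLib

/-!
# Barrier (Schanuel) `LargeTranscendenceDegree`: Waldschmidt's Conjecture 2.3 — what it contains, what the summit gives

`Literature/Barriers/Schanuel/LargeTranscendenceDegreeConjectureProofs.lean` — second sibling
proofs file of `Literature/Barriers/Schanuel/LargeTranscendenceDegree.lean` (the first,
`LargeTranscendenceDegreeProofs.lean`, reduces the barrier declaration = Theorem 2.7 to the tree's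
Diaz facts). No new definitions; proofs only, about the barrier file's
`Literature.Barriers.Schanuel.WaldschmidtConjecture_2_3`.

`WaldschmidtConjecture_2_3` is LNM 1752, Ch. 14 (M. Waldschmidt), Conjecture 2.3 (p. 214, PDF
p. 247), one of the "open problems which might be easier to prove, given the currently available
methods" (§1, p. 213): for `ℚ`-linearly independent `x₁, …, x_d` and `y₁, …, y_ℓ` (`d, ℓ ≥ 2`) and
`K ∋ e^{xᵢyⱼ}`, `K₁ = K(x)`, `K₂ = K₁(y)` of transcendence degrees `t, t₁, t₂`:
`t > dℓ/(ℓ+d) − 1`, `t₁ > (d−1)ℓ/(ℓ+d)`, `t₂ > dℓ/(ℓ+d)`. It is an OPEN CONJECTURE — no proof is in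
print ("The conjectures … of [NP2001] Chap. 14, §2 are not yet proved", Waldschmidt 2004, §3.1) —
and NOT a theorem awaiting a discharge `WaldschmidtConjecture_2_3_holds`. This file proves,
sorry-free, the two printed/folklore facts that locate it between registered open statements of
the tree:

* `fourExponentialsConjecture_of_waldschmidtConjecture_2_3` — **Conjecture 2.3 "includes also the
  Four Exponentials Conjecture"** (the sentence introducing it, p. 214): its `t`-clause for
  `d = ℓ = 2` is `trdeg_ℚ ℚ(e^{xᵢyⱼ}) ≥ [4/4] = 1`, i.e. the four numbers `e^{xᵢyⱼ}` are not all
  algebraic, which is the tree's `Literature.NumberTheory.Transcendental.FourExponentialsConjecture`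
  (`PeriodsWave0.lean`, **periods.S14**, `[status: open]`). So any proof of Conjecture 2.3 proves
  the four exponentials conjecture.
* What the summit `Schanuel` (`∀ n, Literature.NumberTheory.Transcendental.SchanuelRank n`) gives
  on the same data with NO hypothesis on the products `xᵢyⱼ` (the barrier file's
  `conj_2_3_t₂_of_schanuel` assumed the `dℓ` products `ℚ`-linearly independent): Schanuel's
  conjecture applied to ONE COLUMN `(x₁y₁, …, x_dy₁)` — `ℚ`-linearly independent because `x` is
  and `y₁ ≠ 0` — gives `t₂ ≥ d` (`le_trdeg_gridField₂_of_schanuel_linearIndependent`), hence the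
  `t₂`-clause `t₂ ≥ [dℓ/(ℓ+d)] + 1` (`conj_2_3_t₂_of_schanuel'`, as `dℓ/(ℓ+d) < d`); and, since
  `K₁(y₁) ⊇ ℚ(xᵢy₁, e^{xᵢy₁})` while adjoining the single element `y₁` raises `trdeg` by at most
  one (`Literature.NumberTheory.Transcendental.trdeg_adjoin_insert_le`), `t₁ ≥ d − 1`
  (`pred_le_trdeg_gridField₁_of_schanuel`), hence the `t₁`-clause `t₁ ≥ [d(ℓ+1)/(ℓ+d)]` for
  `d ≥ 2` (`conj_2_3_t₁_of_schanuel`). With the tree's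
  `Literature.NumberTheory.Transcendental.fourExponentialsConjecture_of_schanuel` this gives the
  whole conjecture for `d = ℓ = 2` from Schanuel (`conj_2_3_two_two_of_schanuel`).
* `conj_2_3_t_of_schanuel`, `waldschmidtConjecture_2_3_of_schanuel` — **Schanuel's conjecture
  implies Conjecture 2.3 in full** (all `d, ℓ ≥ 2`, all separately independent `x`, `y`). The
  `t`-clause comes from `Literature/NumberTheory/Transcendental/RankOneGridTrdegSchanuel.lean`
  (`min_sub_one_le_trdeg_exp_grid_of_schanuel`: Schanuel ⟹ `t ≥ min(d, ℓ) - 1`, by the rank-one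
  grid inequality `trdeg_ℚ ℚ(xᵢyⱼ) + min(d,ℓ) - 1 ≤ dim_ℚ span_ℚ{xᵢyⱼ}` of `RankOneGridTrdeg.lean` /
  `RankOneGridTrdegSchanuel.lean` against Schanuel applied to a `ℚ`-basis of the span chosen among
  the products) and `[dℓ/(ℓ+d)] ≤ min(d, ℓ) - 1`. So the chain
  `Schanuel ⟹ WaldschmidtConjecture_2_3 ⟹ FourExponentialsConjecture` is proved in tree.

## What is NOT here

No unconditional statement about `WaldschmidtConjecture_2_3` (open). The derivation of the
`t`-clause from Schanuel rests on the purely algebraic inequality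
`trdeg_ℚ ℚ(xᵢyⱼ) + (min(d, ℓ) - 1) ≤ dim_ℚ span_ℚ{xᵢyⱼ}` for separately `ℚ`-linearly independent
`x`, `y`, which is not in the sources; it is proved in tree
(`Literature.NumberTheory.Transcendental.trdeg_add_min_sub_one_le_finrank_grid`, our proof).

## References

* [NesterenkoPhilippon2001] Yu. V. Nesterenko, P. Philippon (eds.), *Introduction to Algebraic
  Independence Theory*, LNM 1752 (2001), Ch. 14 (M. Waldschmidt) §1 p. 213 ("we only propose some
  open problems"), §2.1 Conjecture 2.3 and the sentence before it, p. 214 (PDF p. 247); Remark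
  after Theorem 2.7, p. 215 (integer forms `[dℓ/(ℓ+d)]`, `[d(ℓ+1)/(ℓ+d)]`).
* [Waldschmidt2004] M. Waldschmidt, *Open Diophantine Problems*, Moscow Math. J. 4 (2004), §3.1
  ("The conjectures … of [NP2001] Chap. 14, §2 are not yet proved").
* [Waldschmidt2005] M. Waldschmidt, *Variations on the six exponentials theorem* (2005), §1
  Conjecture 1.2 (four exponentials; the tree's `FourExponentialsConjecture`).
-/

noncomputable section

open Complex IntermediateField

namespace Literature.Barriers.Schanuel

variable {d l : ℕ}

/-! ### Schanuel on one column; the `t₂`- and `t₁`-clauses -/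

/-- **Schanuel on one column of the grid.** If `x₁, …, x_d` are `ℚ`-linearly independent and
`c ≠ 0`, then `x₁c, …, x_dc` are `ℚ`-linearly independent, so Schanuel's conjecture gives
`trdeg_ℚ L ≥ d` for every field `L` containing the `xᵢc` and the `e^{xᵢc}`. [folklore] -/
theorem le_trdeg_of_schanuel_column
    (hSC : ∀ n, Literature.NumberTheory.Transcendental.SchanuelRank n) {x : Fin d → ℂ}
    (hx : LinearIndependent ℚ x) {c : ℂ} (hc : c ≠ 0) {L : IntermediateField ℚ ℂ}
    (hmul : ∀ i, x i * c ∈ L) (hexp : ∀ i, cexp (x i * c) ∈ L) :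
    (d : Cardinal) ≤ Algebra.trdeg ℚ L := by
  set z : Fin d → ℂ := fun i => x i * c with hz_def
  have hz : LinearIndependent ℚ z := by
    rw [Fintype.linearIndependent_iff] at hx ⊢
    intro g hg i
    refine hx g ?_ i
    have hsum : (∑ k, g k • x k) * c = 0 := by
      rw [Finset.sum_mul]
      simpa [hz_def, smul_mul_assoc] using hg
    exact (mul_eq_zero.mp hsum).resolve_right hc
  refine (hSC d z hz).trans (trdeg_mono ?_)
  rw [adjoin_le_iff]
  rintro w (⟨i, rfl⟩ | ⟨i, rfl⟩)
  · exact hmul i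
  · exact hexp i

/-- **Schanuel ⟹ `t₂ ≥ d`** for `ℚ`-linearly independent `x` and `y` with `ℓ ≥ 1` (no hypothesis
on the products): `K₂ = ℚ(x, y, e^{xᵢyⱼ})` contains the column `xᵢy₁` and its exponentials.
[folklore] -/
theorem le_trdeg_gridField₂_of_schanuel_linearIndependent
    (hSC : ∀ n, Literature.NumberTheory.Transcendental.SchanuelRank n) (x : Fin d → ℂ) (y : Fin l → ℂ)
    (hx : LinearIndependent ℚ x) (hy : LinearIndependent ℚ y) (hl : 1 ≤ l) :
    (d : Cardinal) ≤ Algebra.trdeg ℚ (gridField₂ x y) := by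
  set j : Fin l := ⟨0, hl⟩
  refine le_trdeg_of_schanuel_column hSC hx (hy.ne_zero j) (fun i => ?_) (fun i => ?_)
  · exact mul_mem (subset_adjoin ℚ _ (Or.inl (Or.inl ⟨i, rfl⟩)))
      (subset_adjoin ℚ _ (Or.inl (Or.inr ⟨j, rfl⟩)))
  · exact subset_adjoin ℚ _ (Or.inr ⟨(i, j), rfl⟩)

/-- **Schanuel ⟹ the `t₂`-clause of Conjecture 2.3 in general**: for `ℚ`-linearly independent
`x₁, …, x_d` and `y₁, …, y_ℓ` (`d, ℓ ≥ 1`), `t₂ ≥ [dℓ/(ℓ+d)] + 1` — because `t₂ ≥ d` and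
`dℓ/(ℓ+d) < d`. This removes the hypothesis "the products `xᵢyⱼ` are `ℚ`-linearly independent" of
`conj_2_3_t₂_of_schanuel`. [cite: NesterenkoPhilippon2001, Ch. 14 Conjecture 2.3 (t₂ clause)] -/
theorem conj_2_3_t₂_of_schanuel'
    (hSC : ∀ n, Literature.NumberTheory.Transcendental.SchanuelRank n) (x : Fin d → ℂ) (y : Fin l → ℂ)
    (hx : LinearIndependent ℚ x) (hy : LinearIndependent ℚ y) (hd : 1 ≤ d) (hl : 1 ≤ l) :
    ((d * l / (l + d) + 1 : ℕ) : Cardinal) ≤ Algebra.trdeg ℚ (gridField₂ x y) := by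
  refine le_trans ?_ (le_trdeg_gridField₂_of_schanuel_linearIndependent hSC x y hx hy hl)
  have hlt : d * l / (l + d) < d := by
    rw [Nat.div_lt_iff_lt_mul (by omega)]
    nlinarith
  exact_mod_cast (show d * l / (l + d) + 1 ≤ d by omega)

/-- **Schanuel ⟹ `t₁ ≥ d - 1`** for `ℚ`-linearly independent `x` and `y` with `ℓ ≥ 1`: the field
`K₁(y₁) = ℚ(x, e^{xᵢyⱼ}, y₁)` contains the column `xᵢy₁` and its exponentials, so has
transcendence degree `≥ d` by Schanuel, and adjoining the single element `y₁` to `K₁` raises the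
transcendence degree by at most one (`Literature.NumberTheory.Transcendental.trdeg_adjoin_insert_le`).
[folklore] -/
theorem pred_le_trdeg_gridField₁_of_schanuel
    (hSC : ∀ n, Literature.NumberTheory.Transcendental.SchanuelRank n) (x : Fin d → ℂ) (y : Fin l → ℂ)
    (hx : LinearIndependent ℚ x) (hy : LinearIndependent ℚ y) (hd : 1 ≤ d) (hl : 1 ≤ l) :
    ((d - 1 : ℕ) : Cardinal) ≤ Algebra.trdeg ℚ (gridField₁ x y) := by
  set j : Fin l := ⟨0, hl⟩
  set T : Set ℂ := Set.range x ∪ Set.range (gridExp x y)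
  have h1 : (d : Cardinal) ≤ Algebra.trdeg ℚ (adjoin ℚ (insert (y j) T)) := by
    refine le_trdeg_of_schanuel_column hSC hx (hy.ne_zero j) (fun i => ?_) (fun i => ?_)
    · exact mul_mem (subset_adjoin ℚ _ (Set.mem_insert_of_mem _ (Or.inl ⟨i, rfl⟩)))
        (subset_adjoin ℚ _ (Set.mem_insert _ _))
    · exact subset_adjoin ℚ _ (Set.mem_insert_of_mem _ (Or.inr ⟨(i, j), rfl⟩))
  have h2 := Literature.NumberTheory.Transcendental.trdeg_adjoin_insert_le T (y j)
  have hcast : ((d - 1 : ℕ) : Cardinal) + 1 = (d : Cardinal) := by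
    exact_mod_cast Nat.sub_add_cancel hd
  have h3 : ((d - 1 : ℕ) : Cardinal) + 1 ≤ Algebra.trdeg ℚ (gridField₁ x y) + 1 := by
    rw [hcast]
    exact h1.trans h2
  exact Cardinal.add_one_le_add_one_iff.mp h3

/-- **Schanuel ⟹ the `t₁`-clause of Conjecture 2.3 in general**: for `ℚ`-linearly independent
`x₁, …, x_d` and `y₁, …, y_ℓ` with `d ≥ 2`, `ℓ ≥ 1`, `t₁ ≥ [d(ℓ+1)/(ℓ+d)]` — because `t₁ ≥ d - 1`
(`pred_le_trdeg_gridField₁_of_schanuel`) and `d(ℓ+1)/(ℓ+d) < d` for `d ≥ 2`.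
[cite: NesterenkoPhilippon2001, Ch. 14 Conjecture 2.3 (t₁ clause)] -/
theorem conj_2_3_t₁_of_schanuel
    (hSC : ∀ n, Literature.NumberTheory.Transcendental.SchanuelRank n) (x : Fin d → ℂ) (y : Fin l → ℂ)
    (hx : LinearIndependent ℚ x) (hy : LinearIndependent ℚ y) (hd : 2 ≤ d) (hl : 1 ≤ l) :
    ((d * (l + 1) / (l + d) : ℕ) : Cardinal) ≤ Algebra.trdeg ℚ (gridField₁ x y) := by
  refine le_trans ?_ (pred_le_trdeg_gridField₁_of_schanuel hSC x y hx hy (by omega) hl)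
  have hlt : d * (l + 1) / (l + d) < d := by
    rw [Nat.div_lt_iff_lt_mul (by omega)]
    nlinarith
  exact_mod_cast (show d * (l + 1) / (l + d) ≤ d - 1 by omega)

/-! ### Conjecture 2.3 contains the four exponentials conjecture; the case `d = ℓ = 2` -/

/-- A transcendental element of an intermediate field forces positive transcendence degree.
[folklore] -/
theorem one_le_trdeg_of_transcendental_mem {L : IntermediateField ℚ ℂ} {w : ℂ} (hw : w ∈ L)
    (ht : Transcendental ℚ w) : (1 : Cardinal) ≤ Algebra.trdeg ℚ L := by
  haveI : Algebra.Transcendental ℚ L :=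
    ⟨⟨⟨w, hw⟩, fun h => ht (IntermediateField.isAlgebraic_iff.mp h)⟩⟩
  exact Cardinal.one_le_iff_pos.mpr (trdeg_pos ℚ L)

/-- **Conjecture 2.3 "includes also the Four Exponentials Conjecture"** (LNM 1752, Ch. 14, §2.1,
p. 214, the sentence introducing Conjecture 2.3), PROVED: for `d = ℓ = 2` the `t`-clause reads
`trdeg_ℚ ℚ(e^{x₁y₁}, e^{x₁y₂}, e^{x₂y₁}, e^{x₂y₂}) ≥ [4/4] = 1`, so the four exponentials cannot all
be algebraic (a field generated by algebraic elements has transcendence degree `0`). Hence a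
discharge of `WaldschmidtConjecture_2_3` would prove the tree's registered open statement
`Literature.NumberTheory.Transcendental.FourExponentialsConjecture`.
[cite: NesterenkoPhilippon2001, Ch. 14 §2.1 p. 214 (Conjecture 2.3 "includes also the Four Exponentials Conjecture")] -/
theorem fourExponentialsConjecture_of_waldschmidtConjecture_2_3 (h : WaldschmidtConjecture_2_3) :
    Literature.NumberTheory.Transcendental.FourExponentialsConjecture := by
  intro x y hx hy
  by_contra hne
  have halg : ∀ i j, IsAlgebraic ℚ (cexp (x i * y j)) := fun i j => by
    by_contra hij
    exact hne ⟨i, j, hij⟩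
  obtain ⟨h1, -, -⟩ := h 2 2 x y hx hy le_rfl le_rfl
  haveI : Algebra.IsAlgebraic ℚ (gridField x y) := by
    refine IntermediateField.isAlgebraic_adjoin (fun z hz => ?_)
    obtain ⟨p, rfl⟩ := hz
    exact (halg p.1 p.2).isIntegral
  have h0 : Algebra.trdeg ℚ (gridField x y) = 0 := trdeg_eq_zero
  rw [h0] at h1
  norm_num at h1

/-- **Schanuel ⟹ Conjecture 2.3 for `d = ℓ = 2`** (all three clauses, no hypothesis on the
products): `t ≥ 1` is the four exponentials conjecture, a consequence of Schanuel's conjecture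
(`Literature.NumberTheory.Transcendental.fourExponentialsConjecture_of_schanuel`); `t₁ ≥ [6/4] = 1`
and `t₂ ≥ [4/4] + 1 = 2` are `conj_2_3_t₁_of_schanuel` and `conj_2_3_t₂_of_schanuel'`.
[cite: NesterenkoPhilippon2001, Ch. 14 Conjecture 2.3 (case d = ℓ = 2)] -/
theorem conj_2_3_two_two_of_schanuel
    (hSC : ∀ n, Literature.NumberTheory.Transcendental.SchanuelRank n) (x y : Fin 2 → ℂ)
    (hx : LinearIndependent ℚ x) (hy : LinearIndependent ℚ y) :
    ((2 * 2 / (2 + 2) : ℕ) : Cardinal) ≤ Algebra.trdeg ℚ (gridField x y) ∧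
      ((2 * (2 + 1) / (2 + 2) : ℕ) : Cardinal) ≤ Algebra.trdeg ℚ (gridField₁ x y) ∧
      ((2 * 2 / (2 + 2) + 1 : ℕ) : Cardinal) ≤ Algebra.trdeg ℚ (gridField₂ x y) := by
  refine ⟨?_, conj_2_3_t₁_of_schanuel hSC x y hx hy le_rfl (by norm_num),
    conj_2_3_t₂_of_schanuel' hSC x y hx hy (by norm_num) (by norm_num)⟩
  obtain ⟨i, j, hij⟩ :=
    Literature.NumberTheory.Transcendental.fourExponentialsConjecture_of_schanuel hSC x y hx hy
  have h1 := one_le_trdeg_of_transcendental_mem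
    (show cexp (x i * y j) ∈ gridField x y from subset_adjoin ℚ _ ⟨(i, j), rfl⟩) hij
  norm_num
  exact h1


/-! ### Schanuel ⟹ Conjecture 2.3 in full -/

/-- **Schanuel ⟹ the `t`-clause of Conjecture 2.3 in general**: for `ℚ`-linearly independent
`x₁, …, x_d` and `y₁, …, y_ℓ` (`d, ℓ ≥ 1`), `t = trdeg_ℚ ℚ(e^{xᵢyⱼ}) ≥ [dℓ/(ℓ+d)]`: by
`Literature.NumberTheory.Transcendental.min_sub_one_le_trdeg_exp_grid_of_schanuel`,
`t ≥ min(d, ℓ) - 1`, and `dℓ/(ℓ+d) < min(d, ℓ)`.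
[cite: NesterenkoPhilippon2001, Ch. 14 Conjecture 2.3 (t clause)] -/
theorem conj_2_3_t_of_schanuel
    (hSC : ∀ n, Literature.NumberTheory.Transcendental.SchanuelRank n) (x : Fin d → ℂ) (y : Fin l → ℂ)
    (hx : LinearIndependent ℚ x) (hy : LinearIndependent ℚ y) (hd : 1 ≤ d) (hl : 1 ≤ l) :
    ((d * l / (l + d) : ℕ) : Cardinal) ≤ Algebra.trdeg ℚ (gridField x y) := by
  have h : ((min d l - 1 : ℕ) : Cardinal) ≤ Algebra.trdeg ℚ (gridField x y) :=
    Literature.NumberTheory.Transcendental.min_sub_one_le_trdeg_exp_grid_of_schanuel hSC hx hy hd hl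
  refine le_trans ?_ h
  have hnat : d * l / (l + d) ≤ min d l - 1 := by
    have h1 : d * l / (l + d) < d := by
      rw [Nat.div_lt_iff_lt_mul (by omega)]
      nlinarith
    have h2 : d * l / (l + d) < l := by
      rw [Nat.div_lt_iff_lt_mul (by omega)]
      nlinarith
    omega
  exact_mod_cast hnat

/-- **Schanuel's conjecture implies Waldschmidt's Conjecture 2.3** — all three clauses, for all
`d, ℓ ≥ 2` and all separately `ℚ`-linearly independent `x`, `y` (no hypothesis on the products
`xᵢyⱼ`): the `t`-clause is `conj_2_3_t_of_schanuel`, the `t₁`-clause `conj_2_3_t₁_of_schanuel`,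
the `t₂`-clause `conj_2_3_t₂_of_schanuel'`. Hence the conjectural target of the several-variables
method recorded by the barrier `LargeTranscendenceDegree` is implied by the summit `Schanuel`
(`∀ n, SchanuelRank n`) and implies the four exponentials conjecture
(`fourExponentialsConjecture_of_waldschmidtConjecture_2_3`). PROVED.
[cite: NesterenkoPhilippon2001, Ch. 14 Conjecture 2.3] -/
theorem waldschmidtConjecture_2_3_of_schanuel
    (hSC : ∀ n, Literature.NumberTheory.Transcendental.SchanuelRank n) :
    WaldschmidtConjecture_2_3 := by
  intro d l x y hx hy hd hl
  exact ⟨conj_2_3_t_of_schanuel hSC x y hx hy (by omega) (by omega),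
    conj_2_3_t₁_of_schanuel hSC x y hx hy hd (by omega),
    conj_2_3_t₂_of_schanuel' hSC x y hx hy (by omega) (by omega)⟩

end Literature.Barriers.Schanuel

end
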